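import Literature.Computability.Cryptography.HallgrenClassGroupIdealCount
import Literature.NumberTheory.QuadraticFields.LatticeSumPrincipal
import HarnessLib

/-!
# Hallgren 2005 / class groups — ideals of bounded norm, class by class: the LOWER bound

Topic `Literature/Computability/Cryptography`; proof companion of `HallgrenClassGroupIdealCount.lean`
(which proves the UPPER bound `#{𝔞 ≠ 0 : N𝔞 ≤ N} ≤ ½ h_K (16 N/√|d_K| + 8√N + 1)`). Everything
here is PROVED (theorems only; no definition, no named fact).

Unconditional class-group samplers (draw a near-uniform ideal of norm `≤ N`, read its class) need
the opposite inequality **per class**: every ideal class of an imaginary quadratic field `K` with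
`d_K < −4` contains at least `2N/√|d_K| − 2√N − 1` non-zero integral ideals of norm `≤ N`
(`le_card_ideals_of_class`). With `h_K = (w/2π) √|d_K| · L(1, χ)`-type lower bounds this is the
"positive proportion of ideals per class" behind torsion-witness tests (`3 ∣ h(−d)` iff a random
class has order divisible by `3` with probability `≥ 2/3`).

Proof (Davenport, *Multiplicative Number Theory*, Ch. 6 (2)–(4), run as a lower bound):

* `exists_latticePoints_card_ge` — for a form `(a, b, c)` of discriminant `D < 0` with `a > 0`,
  `3a² ≤ |D|` (e.g. a reduced form, or its opposite `(a, −b, c)`) there are at least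
  `4N/√|D| − 4√N − 2` non-zero lattice points `v` with `Q(v) ≤ N`: the points of the INSCRIBED box
  `|y| ≤ √(2aN/|D|)`, `|2ax + by| ≤ √(2aN)` of the ellipse `(2ax + by)² + |D|y² ≤ 4aN` (no
  Riemann sums: rows of `≥ √(2aN)/a − 1` integers, `≥ 2√(2aN/|D|) − 1` rows);
* `card_latticePoints_le_two_mul_card_ideals` — for `𝔟 = (A, ω − k)` (`AC = k² − tk − m`) the map
  `λ = uA + v(ω − k) ↦ 𝔞 = (λ)𝔟⁻¹` sends non-zero lattice points with
  `A u² + (t − 2k)uv + C v² ≤ N` to non-zero ideals of norm `≤ N` with `𝔟𝔞` principal, at most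
  two-to-one (`(λ) = (λ') ⇔ λ' = ±λ` for `d_K < −4`, `span_singleton_eq_span_singleton_iff'`);
* `le_card_ideals_of_class` — every class is `[𝔞_Q]⁻¹` for a reduced `Q` (`reducedForms_mk0_bijective`),
  and the norm form of `𝔞_Q` is the opposite form `(A, −B, C)`, reduced up to the sign of `B`.

## References

* H. Davenport, *Multiplicative Number Theory*, 2nd ed., GTM 74 (1980), Ch. 6 [DavenportMNT1980].
* D. A. Cox, *Primes of the form x² + ny²*, 2nd ed. (2013), §7.B Thm. 7.7 [Cox2013].
* A. M. Childs, W. van Dam, Rev. Mod. Phys. 82 (2010), §5.7 [ChildsVandam2010].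
-/

noncomputable section

open scoped nonZeroDivisors
open Module NumberField Finset
open Literature.NumberTheory.EllipticCurves
open Literature.NumberTheory.QuadraticFields.Quadratic
open Literature.NumberTheory.QuadraticFields.BinaryQuadraticForm (reducedForms mem_reducedForms_iff
  discr_apply le_of_isReduced)

namespace Literature.Computability.Cryptography.Hallgren2005

variable {K : Type*} [Field K] [NumberField K]

/-! ### Integers in an interval, from below -/

/-- The integers of `[lo, hi]` number at least `hi − lo − 1`. [folklore] -/
theorem le_card_Icc_ceil_floor (lo hi : ℝ) :
    hi - lo - 1 ≤ ((Finset.Icc ⌈lo⌉ ⌊hi⌋).card : ℝ) := by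
  rw [Int.card_Icc]
  have h1 : ((⌊hi⌋ + 1 - ⌈lo⌉ : ℤ) : ℝ) ≤ (((⌊hi⌋ + 1 - ⌈lo⌉).toNat : ℕ) : ℝ) := by
    have : (⌊hi⌋ + 1 - ⌈lo⌉ : ℤ) ≤ ((⌊hi⌋ + 1 - ⌈lo⌉).toNat : ℤ) := Int.self_le_toNat _
    exact_mod_cast this
  have h2 : hi - 1 < (⌊hi⌋ : ℝ) := Int.sub_one_lt_floor hi
  have h3 : (⌈lo⌉ : ℝ) < lo + 1 := Int.ceil_lt_add_one lo
  push_cast at h1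
  linarith

/-! ### Lattice points of a (reduced) form in a disc, from below -/

/-- **Lattice points of a reduced form in a disc, lower bound.** For a form `(a, b, c)` with
`b² − 4ac = D < 0`, `0 < a` and `3a² ≤ −D` (e.g. a reduced form) there is a finite set of at least
`4N/√|D| − 4√N − 2` non-zero lattice points `v` with `a v₁² + b v₁ v₂ + c v₂² ≤ N` — the box
`|y| ≤ √(2aN)/√|D|`, `|2ax + by| ≤ √(2aN)` inscribed in the ellipse `(2ax + by)² + |D| y² ≤ 4aN`.
[cite: DavenportMNT1980, Ch. 6] -/
theorem exists_latticePoints_card_ge {a b c D : ℤ} (hdisc : b ^ 2 - 4 * a * c = D) (hD : D < 0)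
    (ha : 0 < a) (h3a : 3 * a ^ 2 ≤ -D) (N : ℕ) :
    ∃ T : Finset (ℤ × ℤ), (∀ v ∈ T, v ≠ 0 ∧ a * v.1 ^ 2 + b * v.1 * v.2 + c * v.2 ^ 2 ≤ N) ∧
      4 * N / Real.sqrt (-D : ℝ) - 4 * Real.sqrt N - 2 ≤ (T.card : ℝ) := by
  classical
  -- real parameters
  have haR : (0 : ℝ) < a := by exact_mod_cast ha
  have ha1R : (1 : ℝ) ≤ a := by exact_mod_cast ha
  have hDR : (0 : ℝ) < -D := by exact_mod_cast (by linarith : (0 : ℤ) < -D)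
  have h3aR : 3 * (a : ℝ) ^ 2 ≤ -D := by exact_mod_cast h3a
  have hN0 : (0 : ℝ) ≤ N := Nat.cast_nonneg N
  set r : ℝ := Real.sqrt (-D : ℝ) with hr
  set s : ℝ := Real.sqrt (2 * (a : ℝ) * N) with hs
  have hr0 : 0 < r := Real.sqrt_pos.mpr hDR
  have hs0 : 0 ≤ s := Real.sqrt_nonneg _
  have hrsq : r ^ 2 = -D := Real.sq_sqrt hDR.le
  have hssq : s ^ 2 = 2 * a * N := Real.sq_sqrt (by positivity)
  set Y₀ : ℝ := s / r with hY₀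
  have hY₀0 : 0 ≤ Y₀ := div_nonneg hs0 hr0.le
  -- the rows of the box
  let lo : ℤ → ℝ := fun y => (-s - b * y) / (2 * a)
  let hi : ℤ → ℝ := fun y => (s - b * y) / (2 * a)
  let row : ℤ → Finset (ℤ × ℤ) := fun y => (Finset.Icc ⌈lo y⌉ ⌊hi y⌋).image fun x => (x, y)
  let S : Finset (ℤ × ℤ) := (Finset.Icc (-⌊Y₀⌋) ⌊Y₀⌋).biUnion row
  have hrow_mem : ∀ (y : ℤ) (v : ℤ × ℤ), v ∈ row y ↔ v.2 = y ∧ lo y ≤ v.1 ∧ (v.1 : ℝ) ≤ hi y := by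
    intro y v
    simp only [row, Finset.mem_image, Finset.mem_Icc, Int.ceil_le, Int.le_floor]
    constructor
    · rintro ⟨x, ⟨h1, h2⟩, rfl⟩
      exact ⟨rfl, h1, h2⟩
    · rintro ⟨hy, h1, h2⟩
      exact ⟨v.1, ⟨h1, h2⟩, by rw [← hy]⟩
  have hS_mem : ∀ v : ℤ × ℤ, v ∈ S ↔ |v.2| ≤ ⌊Y₀⌋ ∧ lo v.2 ≤ v.1 ∧ (v.1 : ℝ) ≤ hi v.2 := by
    intro v
    simp only [S, Finset.mem_biUnion, Finset.mem_Icc, abs_le]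
    constructor
    · rintro ⟨y, hy, hv⟩
      obtain ⟨rfl, h1, h2⟩ := (hrow_mem y v).1 hv
      exact ⟨hy, h1, h2⟩
    · rintro ⟨hy, h1, h2⟩
      exact ⟨v.2, hy, (hrow_mem v.2 v).2 ⟨rfl, h1, h2⟩⟩
  -- every point of the box has `Q(v) ≤ N`
  have hS_val : ∀ v ∈ S, a * v.1 ^ 2 + b * v.1 * v.2 + c * v.2 ^ 2 ≤ N := by
    intro v hv
    obtain ⟨hy, h1, h2⟩ := (hS_mem v).1 hv
    set x : ℤ := v.1 with hx
    set y : ℤ := v.2 with hy'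
    -- `|2ax + by| ≤ s`
    have hlin1 : -s ≤ 2 * (a : ℝ) * x + b * y := by
      have : (-s - b * y) / (2 * a) ≤ (x : ℝ) := h1
      rw [div_le_iff₀ (by linarith)] at this
      linarith
    have hlin2 : 2 * (a : ℝ) * x + b * y ≤ s := by
      have : (x : ℝ) ≤ (s - b * y) / (2 * a) := h2
      rw [le_div_iff₀ (by linarith)] at this
      linarith
    have hlin : (2 * (a : ℝ) * x + b * y) ^ 2 ≤ s ^ 2 := by
      nlinarith
    -- `|y| ≤ Y₀`, so `(−D) y² ≤ (−D) Y₀² = s²`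
    have hyR : |(y : ℝ)| ≤ Y₀ := by
      have h' : ((|y| : ℤ) : ℝ) ≤ ((⌊Y₀⌋ : ℤ) : ℝ) := by exact_mod_cast hy
      rw [Int.cast_abs] at h'
      exact h'.trans (Int.floor_le Y₀)
    have hy2 : (-D : ℝ) * (y : ℝ) ^ 2 ≤ s ^ 2 := by
      have h' : (y : ℝ) ^ 2 ≤ Y₀ ^ 2 := by
        rw [← sq_abs]
        exact pow_le_pow_left₀ (abs_nonneg _) hyR 2
      have hY₀sq : (-D : ℝ) * Y₀ ^ 2 = s ^ 2 := by
        rw [hY₀, div_pow, hrsq.symm]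
        field_simp
      calc (-D : ℝ) * (y : ℝ) ^ 2 ≤ (-D : ℝ) * Y₀ ^ 2 :=
            mul_le_mul_of_nonneg_left h' hDR.le
        _ = s ^ 2 := hY₀sq
    -- `4a Q(x, y) = (2ax + by)² + (−D) y² ≤ 2 s² = 4 a N`
    have hkey : 4 * (a : ℝ) * (a * x ^ 2 + b * x * y + c * y ^ 2) ≤ 4 * a * N := by
      have e : 4 * (a : ℝ) * (a * x ^ 2 + b * x * y + c * y ^ 2) =
          (2 * (a : ℝ) * x + b * y) ^ 2 + (-D : ℝ) * (y : ℝ) ^ 2 := by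
        have hdiscR : ((b : ℝ)) ^ 2 - 4 * a * c = D := by exact_mod_cast hdisc
        rw [← hdiscR]; ring
      rw [e]
      nlinarith
    have hQR : ((a * x ^ 2 + b * x * y + c * y ^ 2 : ℤ) : ℝ) ≤ (N : ℝ) := by
      push_cast
      nlinarith
    exact_mod_cast hQR
  -- the origin is in the box
  have h0S : (0 : ℤ × ℤ) ∈ S := by
    rw [hS_mem]
    refine ⟨?_, ?_, ?_⟩
    · simp only [Prod.snd_zero, abs_zero]
      exact Int.floor_nonneg.mpr hY₀0
    · show (-s - b * ((0 : ℤ × ℤ).2 : ℤ)) / (2 * a) ≤ ((0 : ℤ × ℤ).1 : ℤ)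
      simp only [Prod.snd_zero, Prod.fst_zero, Int.cast_zero, mul_zero, sub_zero]
      exact div_nonpos_of_nonpos_of_nonneg (by linarith) (by linarith)
    · show (((0 : ℤ × ℤ).1 : ℤ) : ℝ) ≤ (s - b * ((0 : ℤ × ℤ).2 : ℤ)) / (2 * a)
      simp only [Prod.snd_zero, Prod.fst_zero, Int.cast_zero, mul_zero, sub_zero]
      positivity
  -- counting the box: `#S ≥ (2⌊Y₀⌋ + 1)(s/a − 1)`
  have hrow_card : ∀ y : ℤ, s / a - 1 ≤ ((row y).card : ℝ) := by
    intro y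
    have hinj : Function.Injective fun x : ℤ => (x, y) := fun x x' h => (Prod.mk.inj h).1
    rw [Finset.card_image_of_injective _ hinj]
    have h := le_card_Icc_ceil_floor (lo y) (hi y)
    have hdiff : hi y - lo y = s / a := by
      show (s - b * y) / (2 * a) - (-s - b * y) / (2 * a) = s / a
      field_simp
      ring
    linarith
  have hdisj : ((Finset.Icc (-⌊Y₀⌋) ⌊Y₀⌋ : Finset ℤ) : Set ℤ).PairwiseDisjoint row := by
    intro y _ y' _ hyy'
    refine Finset.disjoint_left.2 fun v hv hv' => hyy' ?_
    obtain ⟨h1, -, -⟩ := (hrow_mem y v).1 hv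
    obtain ⟨h2, -, -⟩ := (hrow_mem y' v).1 hv'
    rw [← h1, ← h2]
  have hYcard : ((Finset.Icc (-⌊Y₀⌋) ⌊Y₀⌋).card : ℝ) = 2 * (⌊Y₀⌋ : ℝ) + 1 := by
    have hfl : (0 : ℤ) ≤ ⌊Y₀⌋ := Int.floor_nonneg.mpr hY₀0
    rw [Int.card_Icc, show ⌊Y₀⌋ + 1 - -⌊Y₀⌋ = 2 * ⌊Y₀⌋ + 1 by ring]
    have : ((2 * ⌊Y₀⌋ + 1).toNat : ℤ) = 2 * ⌊Y₀⌋ + 1 := Int.toNat_of_nonneg (by linarith)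
    exact_mod_cast this
  have hS_card : (2 * (⌊Y₀⌋ : ℝ) + 1) * (s / a - 1) ≤ (S.card : ℝ) := by
    have hsum : S.card = ∑ y ∈ Finset.Icc (-⌊Y₀⌋) ⌊Y₀⌋, (row y).card := Finset.card_biUnion hdisj
    rw [hsum, Nat.cast_sum, ← hYcard]
    have h := Finset.card_nsmul_le_sum (Finset.Icc (-⌊Y₀⌋) ⌊Y₀⌋) (fun y => ((row y).card : ℝ))
      (s / a - 1) fun y _ => hrow_card y
    rwa [nsmul_eq_mul] at h
  -- the set `T = S ∖ {0}`
  refine ⟨S.erase 0, fun v hv => ?_, ?_⟩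
  · obtain ⟨hv0, hvS⟩ := Finset.mem_erase.1 hv
    exact ⟨hv0, hS_val v hvS⟩
  have hT_card : ((S.erase 0).card : ℝ) = S.card - 1 := by
    rw [Finset.card_erase_of_mem h0S]
    have h1 : 1 ≤ S.card := Finset.card_pos.2 ⟨0, h0S⟩
    rw [Nat.cast_sub h1, Nat.cast_one]
  rw [hT_card]
  -- bookkeeping: `s/a ≤ 2√N`, `2Y₀ ≤ 2√N`, `Y₀ s / a = 2N/r`
  have hsN : Real.sqrt N ^ 2 = N := Real.sq_sqrt hN0
  have hsN0 : 0 ≤ Real.sqrt N := Real.sqrt_nonneg _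
  have hu : s / a ≤ 2 * Real.sqrt N := by
    rw [div_le_iff₀ haR]
    have h1 : s ^ 2 ≤ (2 * Real.sqrt N * a) ^ 2 := by
      rw [mul_pow, mul_pow, hsN, hssq]; nlinarith
    nlinarith [sq_nonneg (s - 2 * Real.sqrt N * a), mul_nonneg hsN0 haR.le]
  have hY₀le : Y₀ ≤ Real.sqrt N := by
    rw [hY₀, div_le_iff₀ hr0]
    have h1 : s ^ 2 ≤ (Real.sqrt N * r) ^ 2 := by
      rw [mul_pow, hsN, hssq, hrsq]
      -- `2 a N ≤ N (−D)` from `2a ≤ 3a² ≤ −D`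
      have : 2 * (a : ℝ) ≤ -D := by nlinarith
      nlinarith
    nlinarith [sq_nonneg (s - Real.sqrt N * r), mul_nonneg hsN0 hr0.le]
  have hprod : Y₀ * (s / a) = 2 * N / r := by
    rw [hY₀, div_mul_div_comm, ← sq, hssq]
    field_simp
  have hfloor : Y₀ - 1 < (⌊Y₀⌋ : ℝ) := Int.sub_one_lt_floor Y₀
  rcases le_or_gt 1 (s / a) with hsa | hsa
  · -- main case: `s/a ≥ 1`
    have h1 : (2 * Y₀ - 1) * (s / a - 1) ≤ (2 * (⌊Y₀⌋ : ℝ) + 1) * (s / a - 1) :=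
      mul_le_mul_of_nonneg_right (by linarith) (by linarith)
    have h2 : (2 * Y₀ - 1) * (s / a - 1) = 4 * N / r - 2 * Y₀ - s / a + 1 := by
      have : (2 * Y₀ - 1) * (s / a - 1) = 2 * (Y₀ * (s / a)) - 2 * Y₀ - s / a + 1 := by ring
      rw [this, hprod]; ring
    linarith
  · -- degenerate case: `s < a`, i.e. `2N < a`; the bound is negative
    have h2N : 2 * (N : ℝ) < a := by
      have h1 : s < a := by rwa [div_lt_one haR] at hsa
      have h2 : s ^ 2 < (a : ℝ) ^ 2 := pow_lt_pow_left₀ h1 hs0 two_ne_zero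
      rw [hssq] at h2
      have h2' : (a : ℝ) * (2 * N) < a * a := by linarith
      exact lt_of_mul_lt_mul_left h2' haR.le
    have hra : Real.sqrt 3 * a ≤ r := by
      have h3 : Real.sqrt 3 ^ 2 = 3 := Real.sq_sqrt (by norm_num)
      have h1 : (Real.sqrt 3 * a) ^ 2 ≤ r ^ 2 := by rw [mul_pow, h3, hrsq]; linarith
      have h30 : 0 ≤ Real.sqrt 3 * a := by positivity
      exact (pow_le_pow_iff_left₀ h30 hr0.le two_ne_zero).1 h1
    have h3gt : (1 : ℝ) < Real.sqrt 3 := by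
      rw [show (1 : ℝ) = Real.sqrt 1 from Real.sqrt_one.symm]
      exact Real.sqrt_lt_sqrt (by norm_num) (by norm_num)
    have hbound : 4 * (N : ℝ) / r < 2 := by
      rw [div_lt_iff₀ hr0]
      have h' : (a : ℝ) ≤ r := by linarith only [hra, mul_pos (sub_pos.2 h3gt) haR]
      linarith only [h', h2N]
    have hcard0 : (1 : ℝ) ≤ S.card := by exact_mod_cast Finset.card_pos.2 ⟨0, h0S⟩
    linarith only [hbound, hsN0, hcard0]

/-! ### From lattice points to ideals of a class, at most two-to-one -/

/-- **Lattice points give ideals of the class `[𝔟]⁻¹`, at most two-to-one.** Let `(1, ω)` be an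
integral basis of the imaginary quadratic field `K`, `ω² = m + tω`, `t² + 4m = d_K < −4`, and
`𝔟 = (A, ω − k)` with `A > 0`, `AC = k² − tk − m`. If `T` is a finite set of non-zero lattice points
`(u, v)` with `A u² + (t − 2k) u v + C v² ≤ N`, then
`#T ≤ 2 · #{𝔞 ≠ 0 : N𝔞 ≤ N, 𝔟𝔞 principal}`: `λ = uA + v(ω − k) ↦ 𝔞 = (λ)𝔟⁻¹` has `N𝔞 = N(λ)/N𝔟`
(`norm_lattice_elt`, `absNorm_span_pair_eq`) and `(λ) = (λ') ⇔ λ' = ±λ`. [cite: DavenportMNT1980, Ch. 6 (2)–(4)] -/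
theorem card_latticePoints_le_two_mul_card_ideals (b : Basis (Fin 2) ℤ (𝓞 K)) (hb : b 0 = 1)
    {t m : ℤ} (hω : b 1 * b 1 = (m : 𝓞 K) + (t : 𝓞 K) * b 1) (hD : t ^ 2 + 4 * m < -4)
    {A k C : ℤ} (hA : 0 < A) (hn : A * C = k ^ 2 - t * k - m) (N : ℕ) (T : Finset (ℤ × ℤ))
    (hT : ∀ v ∈ T, v ≠ 0 ∧ A * v.1 ^ 2 + (t - 2 * k) * v.1 * v.2 + C * v.2 ^ 2 ≤ N) :
    T.card ≤ 2 * Set.ncard {I : Ideal (𝓞 K) | I ≠ ⊥ ∧ Ideal.absNorm I ≤ N ∧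
      (Ideal.span {(A : 𝓞 K), b 1 - k} * I).IsPrincipal} := by
  classical
  set 𝔟 : Ideal (𝓞 K) := Ideal.span {(A : 𝓞 K), b 1 - k} with h𝔟
  have h𝔟0 : 𝔟 ≠ 0 := nonZeroDivisors.ne_zero (span_pair_mem_nonZeroDivisors b hb hA.ne' k)
  -- the lattice element and its cofactor ideal
  let φ : ℤ × ℤ → 𝓞 K := fun p => (p.1 : 𝓞 K) * A + (p.2 : 𝓞 K) * (b 1 - k)
  have hφmem : ∀ p, φ p ∈ 𝔟 := fun p => (mem_span_pair_iff_of_basis b hb hω hn _).2 ⟨p.1, p.2, rfl⟩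
  have hdvd : ∀ p, 𝔟 ∣ Ideal.span {φ p} := fun p =>
    Ideal.dvd_iff_le.mpr ((Ideal.span_singleton_le_iff_mem _).mpr (hφmem p))
  let J : ℤ × ℤ → Ideal (𝓞 K) := fun p => Classical.choose (hdvd p)
  have hJ : ∀ p, Ideal.span {φ p} = 𝔟 * J p := fun p => Classical.choose_spec (hdvd p)
  -- `φ p = 0 ↔ p = 0`
  have hφ0 : ∀ p : ℤ × ℤ, φ p = 0 → p = 0 := by
    intro p hp
    have h : (p.1 : 𝓞 K) * A + (p.2 : 𝓞 K) * (b 1 - k) = ((0 : ℤ) : 𝓞 K) * A + ((0 : ℤ) : 𝓞 K) * (b 1 - k) := by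
      rw [show (p.1 : 𝓞 K) * A + (p.2 : 𝓞 K) * (b 1 - k) = φ p from rfl, hp]; push_cast; ring
    obtain ⟨h1, h2⟩ := lattice_coords_unique b hb hA.ne' h
    exact Prod.ext h1 h2
  -- the nonnegativity of the norm form: `4A Q = (2Au + (t − 2k)v)² + (−D) v²`
  have hQnn : ∀ p : ℤ × ℤ, 0 ≤ A * p.1 ^ 2 + (t - 2 * k) * p.1 * p.2 + C * p.2 ^ 2 := by
    intro p
    have e : 4 * A * (A * p.1 ^ 2 + (t - 2 * k) * p.1 * p.2 + C * p.2 ^ 2) =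
        (2 * A * p.1 + (t - 2 * k) * p.2) ^ 2 + (-(t ^ 2 + 4 * m)) * p.2 ^ 2 := by
      linear_combination (4 * p.2 ^ 2) * hn
    have h4 : 0 ≤ 4 * A * (A * p.1 ^ 2 + (t - 2 * k) * p.1 * p.2 + C * p.2 ^ 2) := by
      rw [e]; nlinarith [sq_nonneg (2 * A * p.1 + (t - 2 * k) * p.2), sq_nonneg p.2]
    nlinarith
  -- the norm of `J p`
  have h𝔟N : Ideal.absNorm 𝔟 = A.natAbs := absNorm_span_pair_eq b hb hω hn
  have hnormJ : ∀ p : ℤ × ℤ, (Ideal.absNorm (J p) : ℤ) =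
      A * p.1 ^ 2 + (t - 2 * k) * p.1 * p.2 + C * p.2 ^ 2 := by
    intro p
    have h1 := congrArg Ideal.absNorm (hJ p)
    rw [map_mul, Ideal.absNorm_span_singleton, show φ p = (p.1 : 𝓞 K) * A + (p.2 : 𝓞 K) * (b 1 - k)
      from rfl, norm_lattice_elt b hb hω hn, h𝔟N, Int.natAbs_mul] at h1
    have hA0 : A.natAbs ≠ 0 := Int.natAbs_ne_zero.2 hA.ne'
    have h2 : (A * p.1 ^ 2 + (t - 2 * k) * p.1 * p.2 + C * p.2 ^ 2).natAbs = Ideal.absNorm (J p) :=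
      Nat.eq_of_mul_eq_mul_left (Nat.pos_of_ne_zero hA0) h1
    rw [← h2, Int.natAbs_of_nonneg (hQnn p)]
  -- `J` maps `T` into the target set
  set S : Set (Ideal (𝓞 K)) := {I : Ideal (𝓞 K) | I ≠ ⊥ ∧ Ideal.absNorm I ≤ N ∧
      (Ideal.span {(A : 𝓞 K), b 1 - k} * I).IsPrincipal} with hS
  have hSfin : S.Finite :=
    (Ideal.finite_setOf_absNorm_le (S := 𝓞 K) N).subset fun I hI => hI.2.1
  have hmaps : ∀ p ∈ T, J p ∈ S := by
    intro p hp
    obtain ⟨hp0, hpN⟩ := hT p hp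
    refine ⟨?_, ?_, ?_⟩
    · intro hJ0
      have : Ideal.span {φ p} = ⊥ := by rw [hJ p, hJ0, Ideal.mul_bot]
      rw [Ideal.span_singleton_eq_bot] at this
      exact hp0 (hφ0 p this)
    · have := hnormJ p
      have : (Ideal.absNorm (J p) : ℤ) ≤ N := by rw [this]; exact hpN
      exact_mod_cast this
    · rw [← h𝔟, ← hJ p]
      exact ⟨⟨φ p, rfl⟩⟩
  -- fibres have at most two elements
  have hfib : ∀ I ∈ T.image J, (T.filter fun p => J p = I).card ≤ 2 := by
    intro I hI
    obtain ⟨p₀, hp₀, rfl⟩ := Finset.mem_image.1 hI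
    have hsub : (T.filter fun p => J p = J p₀) ⊆ {p₀, -p₀} := by
      intro p hp
      obtain ⟨-, hpJ⟩ := Finset.mem_filter.1 hp
      have hspan : Ideal.span {φ p₀} = Ideal.span {φ p} := by rw [hJ p₀, hJ p, hpJ]
      rw [Finset.mem_insert, Finset.mem_singleton]
      rcases (span_singleton_eq_span_singleton_iff' b hb hω hD _ _).1 hspan with h | h
      · left
        have h' : (p.1 : 𝓞 K) * A + (p.2 : 𝓞 K) * (b 1 - k) = (p₀.1 : 𝓞 K) * A + (p₀.2 : 𝓞 K) * (b 1 - k) := h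
        obtain ⟨h1, h2⟩ := lattice_coords_unique b hb hA.ne' h'
        exact Prod.ext h1 h2
      · right
        have h' : (p.1 : 𝓞 K) * A + (p.2 : 𝓞 K) * (b 1 - k) =
            ((-p₀.1 : ℤ) : 𝓞 K) * A + ((-p₀.2 : ℤ) : 𝓞 K) * (b 1 - k) := by
          rw [show (p.1 : 𝓞 K) * A + (p.2 : 𝓞 K) * (b 1 - k) = φ p from rfl, h]
          push_cast; ring
        obtain ⟨h1, h2⟩ := lattice_coords_unique b hb hA.ne' h'
        exact Prod.ext h1 h2
    exact (Finset.card_le_card hsub).trans (Finset.card_insert_le _ _ |>.trans (by simp))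
  have h1 : T.card ≤ 2 * (T.image J).card := Finset.card_le_mul_card_image T 2 hfib
  have h2 : (T.image J).card ≤ S.ncard := by
    rw [← Set.ncard_coe_finset]
    exact Set.ncard_le_ncard (fun I hI => by
      obtain ⟨p, hp, rfl⟩ := Finset.mem_image.1 (Finset.mem_coe.1 hI)
      exact hmaps p hp) hSfin
  calc T.card ≤ 2 * (T.image J).card := h1
    _ ≤ 2 * S.ncard := Nat.mul_le_mul_left 2 h2

/-! ### The per-class lower bound -/

/-- **Every ideal class of an imaginary quadratic field with `d_K < −4` contains at least
`2N/√|d_K| − 2√N − 1` non-zero integral ideals of norm `≤ N`.** (Every class is `[𝔞_Q]⁻¹` for a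
reduced form `Q = (A, B, C)`, `reducedForms_mk0_bijective`; the ideals of that class of norm `≤ N`
are the `(λ)𝔞_Q⁻¹`, two-to-one in `λ ∈ 𝔞_Q ∖ 0` with `Q(u, −v) ≤ N`; and the opposite form
`(A, −B, C)` has `≥ 4N/√|d_K| − 4√N − 2` such lattice points, `exists_latticePoints_card_ge`.)
Davenport, Ch. 6; the lower-bound twin of `card_nonzero_ideals_le_classNumber_mul`.
[cite: DavenportMNT1980, Ch. 6] -/
theorem le_card_ideals_of_class (hK : IsImaginaryQuadratic K) (hd4 : NumberField.discr K < -4)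
    (c : ClassGroup (𝓞 K)) (N : ℕ) :
    2 * N / Real.sqrt (-(NumberField.discr K) : ℝ) - 2 * Real.sqrt N - 1 ≤
      Set.ncard {I : Ideal (𝓞 K) | I ≠ ⊥ ∧ Ideal.absNorm I ≤ N ∧
        ∃ hI : I ∈ (Ideal (𝓞 K))⁰, ClassGroup.mk0 ⟨I, hI⟩ = c} := by
  classical
  -- integral basis and discriminant
  obtain ⟨b, hb⟩ := exists_basis_zero_eq_one (K := K) hK.1
  set m : ℤ := b.repr (b 1 * b 1) 0 with hm
  set t : ℤ := b.repr (b 1 * b 1) 1 with ht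
  have hω : b 1 * b 1 = (m : 𝓞 K) + (t : 𝓞 K) * b 1 := basis_one_mul_self_eq b hb
  have hDK : NumberField.discr K = t ^ 2 + 4 * m := discr_eq_sq_add_four_mul b hb
  have hneg : t ^ 2 + 4 * m < 0 := by rw [← hDK]; exact hK.discr_neg
  have hD4 : t ^ 2 + 4 * m < -4 := by rw [← hDK]; exact hd4
  -- a reduced form `Q` with `[𝔞_Q] = c⁻¹`
  obtain ⟨⟨Q, hQ⟩, hcQ⟩ := (reducedForms_mk0_bijective b hb hω hneg).2 c⁻¹
  dsimp only at hcQ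
  obtain ⟨hdiscQ, hA, -, hred⟩ := (mem_reducedForms_iff hneg).1 hQ
  obtain ⟨-, hb1, hb2, hac⟩ := le_of_isReduced hdiscQ hA hred
  rw [discr_apply] at hdiscQ
  set A : ℤ := Q.1 with hAdef
  set Bq : ℤ := Q.2.1 with hBdef
  set C : ℤ := Q.2.2 with hCdef
  set k : ℤ := (Bq + t) / 2 with hk
  have h2k : 2 * k = Bq + t := two_mul_ediv_two_of_disc_eq hdiscQ
  have hn : A * C = k ^ 2 - t * k - m := norm_eq_of_disc_eq hdiscQ h2k
  have htk : t - 2 * k = -Bq := by linarith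
  -- lattice points of the opposite form `(A, −B, C)`
  have hdisc' : (t - 2 * k) ^ 2 - 4 * A * C = t ^ 2 + 4 * m := by rw [htk, ← hdiscQ]; ring
  have h3a : 3 * A ^ 2 ≤ -(t ^ 2 + 4 * m) := by
    have hbb : Bq ^ 2 ≤ A ^ 2 := by nlinarith
    nlinarith
  obtain ⟨T, hT, hTcard⟩ := exists_latticePoints_card_ge hdisc' hneg hA h3a N
  have hle := card_latticePoints_le_two_mul_card_ideals b hb hω hD4 hA hn N T hT
  -- the ideals with `𝔟 I` principal lie in the class `c`
  set 𝔟 : Ideal (𝓞 K) := Ideal.span {(A : 𝓞 K), b 1 - k} with h𝔟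
  have h𝔟0 : 𝔟 ∈ (Ideal (𝓞 K))⁰ := span_pair_mem_nonZeroDivisors b hb hA.ne' _
  have hcQ' : ClassGroup.mk0 ⟨𝔟, h𝔟0⟩ = c⁻¹ := hcQ
  have hsub : {I : Ideal (𝓞 K) | I ≠ ⊥ ∧ Ideal.absNorm I ≤ N ∧ (𝔟 * I).IsPrincipal} ⊆
      {I : Ideal (𝓞 K) | I ≠ ⊥ ∧ Ideal.absNorm I ≤ N ∧
        ∃ hI : I ∈ (Ideal (𝓞 K))⁰, ClassGroup.mk0 ⟨I, hI⟩ = c} := by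
    rintro I ⟨hI0, hIN, hprinc⟩
    have hI : I ∈ (Ideal (𝓞 K))⁰ := mem_nonZeroDivisors_of_ne_zero (by simpa using hI0)
    refine ⟨hI0, hIN, hI, ?_⟩
    obtain ⟨x, hx⟩ := hprinc
    have hx0 : x ≠ 0 := by
      intro hx0
      rw [hx0] at hx
      have : 𝔟 * I = ⊥ := by rw [hx]; simp
      rcases mul_eq_zero.1 (show 𝔟 * I = 0 from this) with h | h
      · exact (nonZeroDivisors.ne_zero h𝔟0) h
      · exact hI0 h
    have hcls : ClassGroup.mk0 ⟨I, hI⟩ = (ClassGroup.mk0 ⟨𝔟, h𝔟0⟩)⁻¹ :=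
      ClassGroup.mk0_eq_mk0_inv_iff.mpr ⟨x, hx0, by
        show I * 𝔟 = Ideal.span {x}
        rw [mul_comm]; exact hx⟩
    rw [hcls, hcQ', inv_inv]
  have hfin : {I : Ideal (𝓞 K) | I ≠ ⊥ ∧ Ideal.absNorm I ≤ N ∧
      ∃ hI : I ∈ (Ideal (𝓞 K))⁰, ClassGroup.mk0 ⟨I, hI⟩ = c}.Finite :=
    (Ideal.finite_setOf_absNorm_le (S := 𝓞 K) N).subset fun I hI => hI.2.1
  have hmono := Set.ncard_le_ncard hsub hfin
  have hchain : (T.card : ℝ) ≤ 2 * (Set.ncard {I : Ideal (𝓞 K) | I ≠ ⊥ ∧ Ideal.absNorm I ≤ N ∧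
      ∃ hI : I ∈ (Ideal (𝓞 K))⁰, ClassGroup.mk0 ⟨I, hI⟩ = c} : ℝ) := by
    have : (T.card : ℝ) ≤ ((2 * Set.ncard {I : Ideal (𝓞 K) | I ≠ ⊥ ∧ Ideal.absNorm I ≤ N ∧
        (𝔟 * I).IsPrincipal} : ℕ) : ℝ) := by exact_mod_cast hle
    push_cast at this
    have hmonoR : (Set.ncard {I : Ideal (𝓞 K) | I ≠ ⊥ ∧ Ideal.absNorm I ≤ N ∧
        (𝔟 * I).IsPrincipal} : ℝ) ≤ Set.ncard {I : Ideal (𝓞 K) | I ≠ ⊥ ∧ Ideal.absNorm I ≤ N ∧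
        ∃ hI : I ∈ (Ideal (𝓞 K))⁰, ClassGroup.mk0 ⟨I, hI⟩ = c} := by exact_mod_cast hmono
    linarith
  have hDR : Real.sqrt (-(NumberField.discr K) : ℝ) = Real.sqrt (-(t ^ 2 + 4 * m : ℤ) : ℝ) := by
    rw [hDK]
  rw [hDR]
  have hT' : 4 * N / Real.sqrt (-(t ^ 2 + 4 * m : ℤ) : ℝ) - 4 * Real.sqrt N - 2 ≤ (T.card : ℝ) := by
    exact_mod_cast hTcard
  have key : 2 * (2 * N / Real.sqrt (-(t ^ 2 + 4 * m : ℤ) : ℝ) - 2 * Real.sqrt N - 1) ≤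
      2 * (Set.ncard {I : Ideal (𝓞 K) | I ≠ ⊥ ∧ Ideal.absNorm I ≤ N ∧
        ∃ hI : I ∈ (Ideal (𝓞 K))⁰, ClassGroup.mk0 ⟨I, hI⟩ = c} : ℝ) := by
    have e : 2 * (2 * N / Real.sqrt (-(t ^ 2 + 4 * m : ℤ) : ℝ) - 2 * Real.sqrt N - 1) =
        4 * N / Real.sqrt (-(t ^ 2 + 4 * m : ℤ) : ℝ) - 4 * Real.sqrt N - 2 := by ring
    rw [e]
    exact hT'.trans hchain
  linarith [key]

end Literature.Computability.Cryptography.Hallgren2005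

end
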